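import Literature.AlgebraicGeometry.HodgeTheory.QuaternionicQuarticDeckChart
import Literature.AlgebraicGeometry.Motives.VarietiesRegularProofs
import Mathlib.RingTheory.Etale.StandardEtale
import Mathlib.RingTheory.RegularLocalRing.Polynomial
import HarnessLib

/-!
# The étale chart of the normalised quaternionic quartic cover IS standard étale over the `(u₀, u₁)`-plane
# (programme «M1», brick M1-0a′: the dictionary `DeckRing a ≅ (R[u][w]/(w⁴ − g))[1/h]`, regularity)

Layer `Literature/AlgebraicGeometry/HodgeTheory`. Definitions + proved API (no named fact). Written by the prover
seat `hodge-nonav-prover-Bx` (g19, cell `hodge-nonav`), programme M1 (memo `PROGRAMME-M1-Bx-g19.md`) for route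
`HodgeConjecture/Q8SymplecticPowers` (crux K1Q, stmt-HodgeConjecture-24190). Sequel of
`QuaternionicQuarticDeckChart` (`DeckRing a = R[u₀, u₁, w, w₁, w₂, v]/(r₁, …, r₇)`).

With `R₀ = R[u₀, u₁]` and the dehomogenised forms `c, σc, α, ψ ∈ R₀`, `g = c (σc)³ α² ψ²`, `h = c σc α ψ`, the
chart is the STANDARD ÉTALE `R₀`-algebra of Mathlib's `StandardEtalePair` `(f, g) = (X⁴ − g, h)`:

  `DeckRing a ≃ₐ[R₀] R₀[X][Y]/(X⁴ − g, Y h − 1)`  (`X ↦ w`, `Y ↦ v`; inverse `w₁ ↦ c Y X²`, `w₂ ↦ c² α ψ Y² X³`),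

the pair being standard étale because `4X³ · (¼ m X) − (X⁴ − g) · m = g m = h⁴` with `m = c³ σc α² ψ²` (`4` is a
unit in the `ℂ`-algebra `R`). Consequences (instance-free statements): over a FIELD `K ⊇ ℂ` the chart ring is a
REGULAR ring (`isRegularRing_deckRing`: étale over the regular ring `K[u₀, u₁]`, via the tree's
`IsRegularLocalRing.of_etale` and Mathlib's `MvPolynomial.isRegularRing_of_isRegularRing`), and it is a DOMAIN as
soon as `X⁴ − g` is prime in `K[u₀, u₁][X]` and `h ≠ 0` (`isDomain_deckRing_of_prime`; the primality — Eisenstein at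
`c` — is the business of the sequel `QuaternionicQuarticDeckChartIntegral`).

Contents of THIS file: `dehom₂`, `c₂`, `c₂'`, `α₂`, `ψ₂`, `g₂`, `h₂`, `m₂` and their images `cU, …` under `toSix`;
the identities `w⁴ = g`, `v h = 1`, `w₁ = c v w²`, `w₂ = c² α ψ v² w³` in `DeckRing a`; `deckPair a`; the `R₀`-algebra
structure `baseAlgebra a` on `DeckRing a` (a `def`, used as a LOCAL instance only); `deckLift` (`= P.lift w`) and
`pairY` with `Ψ X = w`, `Ψ Y = v`. The inverse `deckToPair`, the equivalence `deckRingEquivPair` and the two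
consequences are in the sequel `QuaternionicQuarticDeckChartEtaleEquiv`.

Honest scope: explicit commutative algebra for one family of surfaces; nothing here bears on HC.

## References

* [StacksProject] The Stacks Project, Tag 00UB (standard étale algebras), Tag 00TV (étale over regular).
* [Kollar2007] J. Kollár, Lectures on Resolution of Singularities (2007), §3.3, §3.4.1.
* [Hartshorne1977] R. Hartshorne, Algebraic Geometry (1977), II Ex. 2.14.
-/

noncomputable section

open MvPolynomial

namespace Literature.AlgebraicGeometry.HodgeTheory.Q8Family

universe v

/-! ### The forms in the two base variables and the dictionary with the chart variables -/

section Base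

variable {R : Type v} [CommRing R] {e : ℕ} (a : CIdx e → R)

/-- Dehomogenisation at `x₂ = 1` into `R₀ = R[u₀, u₁] = MvPolynomial (Fin 2) R`. [cite: Hartshorne1977, II Ex. 2.14] -/
def dehom₂ : MvPolynomial (Fin 3) R →ₐ[R] MvPolynomial (Fin 2) R :=
  aeval ![X 0, X 1, 1]

/-- `c(u₀, u₁, 1) ∈ R₀`. [cite: Kollar2007, §3.3] -/
def c₂ : MvPolynomial (Fin 2) R := dehom₂ (cOfR a)

/-- `(σc)(u₀, u₁, 1) ∈ R₀`. [cite: Kollar2007, §3.3] -/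
def c₂' : MvPolynomial (Fin 2) R := dehom₂ (rename (Equiv.swap (0 : Fin 3) 1) (cOfR a))

/-- `α = u₀ − u₁ ∈ R₀`. [cite: Kollar2007, §3.3] -/
def α₂ : MvPolynomial (Fin 2) R := X 0 - X 1

/-- `ψ(u₀, u₁, 1) ∈ R₀`. [cite: Kollar2007, §3.3] -/
def ψ₂ : MvPolynomial (Fin 2) R := dehom₂ (ψOfR a)

/-- `g = c (σc)³ α² ψ² ∈ R₀`. [cite: Kollar2007, §3.3] -/
def g₂ : MvPolynomial (Fin 2) R := c₂ a * c₂' a ^ 3 * α₂ ^ 2 * ψ₂ a ^ 2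

/-- `h = c σc α ψ ∈ R₀`. [cite: Kollar2007, §3.3] -/
def h₂ : MvPolynomial (Fin 2) R := c₂ a * c₂' a * α₂ * ψ₂ a

/-- `m = c³ σc α² ψ² ∈ R₀`, the cofactor with `h⁴ = g m`. [cite: Kollar2007, §3.3] -/
def m₂ : MvPolynomial (Fin 2) R := c₂ a ^ 3 * c₂' a * α₂ ^ 2 * ψ₂ a ^ 2

/-- `h⁴ = g m`. [cite: Kollar2007, §3.3] -/
theorem h₂_pow_four : h₂ a ^ 4 = g₂ a * m₂ a := by
  simp only [h₂, g₂, m₂]; ring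

/-- The base variables into the chart ring: `R₀ = R[u₀, u₁] → R[u₀, u₁, w, w₁, w₂, v]`. [cite: Hartshorne1977, II Ex. 2.14] -/
def toSix : MvPolynomial (Fin 2) R →ₐ[R] MvPolynomial (Fin 6) R :=
  aeval ![X 0, X 1]

/-- `toSix` on `u₀`. [cite: Hartshorne1977, II Ex. 2.14] -/
@[simp] theorem toSix_X0 : toSix (X 0 : MvPolynomial (Fin 2) R) = X 0 := by simp [toSix]

/-- `toSix` on `u₁`. [cite: Hartshorne1977, II Ex. 2.14] -/
@[simp] theorem toSix_X1 : toSix (X 1 : MvPolynomial (Fin 2) R) = X 1 := by simp [toSix]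

/-- `toSix ∘ dehom₂ = dehom`. [cite: Hartshorne1977, II Ex. 2.14] -/
theorem toSix_dehom₂ (p : MvPolynomial (Fin 3) R) : toSix (dehom₂ p) = dehom p := by
  change (toSix.comp dehom₂) p = dehom p
  congr 1
  refine MvPolynomial.algHom_ext fun i => ?_
  fin_cases i <;> simp [toSix, dehom₂, dehom]

/-- `toSix c₂ = cU`. [cite: Kollar2007, §3.3] -/
@[simp] theorem toSix_c₂ : toSix (c₂ a) = cU a := toSix_dehom₂ _
/-- `toSix c₂' = cU'`. [cite: Kollar2007, §3.3] -/
@[simp] theorem toSix_c₂' : toSix (c₂' a) = cU' a := toSix_dehom₂ _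
/-- `toSix α₂ = αU`. [cite: Kollar2007, §3.3] -/
@[simp] theorem toSix_α₂ : toSix (α₂ : MvPolynomial (Fin 2) R) = αU := by simp [α₂, αU]
/-- `toSix ψ₂ = ψU`. [cite: Kollar2007, §3.3] -/
@[simp] theorem toSix_ψ₂ : toSix (ψ₂ a) = ψU a := toSix_dehom₂ _
/-- `toSix h₂ = hU`. [cite: Kollar2007, §3.3] -/
@[simp] theorem toSix_h₂ : toSix (h₂ a) = hU a := by simp [h₂, hU]
/-- `toSix g₂ = gU`. [cite: Kollar2007, §3.3] -/
@[simp] theorem toSix_g₂ : toSix (g₂ a) = gU a := by simp [g₂, gU]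

/-- **The `R₀`-algebra structure on the chart ring** (`u₀, u₁ ↦ u₀, u₁`); a `def`, used below as a LOCAL
instance only. [cite: Hartshorne1977, II Ex. 2.14] -/
@[reducible] def baseAlgebra : Algebra (MvPolynomial (Fin 2) R) (DeckRing a) :=
  (((Ideal.Quotient.mkₐ R (deckIdeal a)).comp toSix) : MvPolynomial (Fin 2) R →+* DeckRing a).toAlgebra

attribute [local instance] baseAlgebra

/-- The structure map of `baseAlgebra` is `mk ∘ toSix`. [cite: Hartshorne1977, II Ex. 2.14] -/
theorem algebraMap_base_apply (p : MvPolynomial (Fin 2) R) :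
    algebraMap (MvPolynomial (Fin 2) R) (DeckRing a) p = Ideal.Quotient.mk (deckIdeal a) (toSix p) := rfl

/-- `R → R₀ → DeckRing a` is the given `R`-algebra structure. [cite: Hartshorne1977, II Ex. 2.14] -/
theorem isScalarTower_base : IsScalarTower R (MvPolynomial (Fin 2) R) (DeckRing a) :=
  IsScalarTower.of_algebraMap_eq fun r => by
    rw [algebraMap_base_apply, MvPolynomial.algebraMap_eq, algHom_C, MvPolynomial.algebraMap_eq,
      ← Ideal.Quotient.mk_algebraMap, MvPolynomial.algebraMap_eq]

attribute [local instance] isScalarTower_base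

/-- In the chart ring, `w⁴ = g`. [cite: Kollar2007, §3.3] -/
theorem mk_X2_pow_four :
    (Ideal.Quotient.mk (deckIdeal a) (X 2) : DeckRing a) ^ 4 = Ideal.Quotient.mk (deckIdeal a) (gU a) := by
  rw [← map_pow, Ideal.Quotient.eq]
  have h : (X 2 : MvPolynomial (Fin 6) R) ^ 4 - gU a =
      (X 2 ^ 2 + X 3 * cU' a * αU * ψU a) * rel a 1 + (cU' a ^ 2 * αU ^ 2 * ψU a ^ 2) * rel a 0 := by
    simp only [rel, gU]; ring
  rw [h]
  exact (deckIdeal a).add_mem ((deckIdeal a).mul_mem_left _ (rel_mem_deckIdeal a 1))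
    ((deckIdeal a).mul_mem_left _ (rel_mem_deckIdeal a 0))

/-- In the chart ring, `v h = 1`. [cite: Kollar2007, §3.3] -/
theorem mk_X5_mul_hU :
    (Ideal.Quotient.mk (deckIdeal a) (X 5) : DeckRing a) * Ideal.Quotient.mk (deckIdeal a) (hU a) = 1 := by
  rw [← map_mul, ← (Ideal.Quotient.mk (deckIdeal a)).map_one, Ideal.Quotient.eq]
  simpa [rel] using rel_mem_deckIdeal a 6

/-- In the chart ring, `w₁ = c v w²`. [cite: Kollar2007, §3.3] -/
theorem mk_X3_eq :
    (Ideal.Quotient.mk (deckIdeal a) (X 3) : DeckRing a) = Ideal.Quotient.mk (deckIdeal a) (cU a * X 5 * X 2 ^ 2) := by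
  rw [Ideal.Quotient.eq]
  have h : (X 3 : MvPolynomial (Fin 6) R) - cU a * X 5 * X 2 ^ 2 = (-(cU a * X 5)) * rel a 1 + (-X 3) * rel a 6 := by
    simp only [rel, hU]; ring
  rw [h]
  exact (deckIdeal a).add_mem ((deckIdeal a).mul_mem_left _ (rel_mem_deckIdeal a 1))
    ((deckIdeal a).mul_mem_left _ (rel_mem_deckIdeal a 6))

/-- In the chart ring, `w₂ = c² α ψ v² w³`. [cite: Kollar2007, §3.3] -/
theorem mk_X4_eq :
    (Ideal.Quotient.mk (deckIdeal a) (X 4) : DeckRing a) =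
      Ideal.Quotient.mk (deckIdeal a) (cU a ^ 2 * αU * ψU a * X 5 ^ 2 * X 2 ^ 3) := by
  rw [Ideal.Quotient.eq]
  have h : (X 4 : MvPolynomial (Fin 6) R) - cU a ^ 2 * αU * ψU a * X 5 ^ 2 * X 2 ^ 3 =
      (-(cU a ^ 2 * αU * ψU a * X 5 ^ 2 * X 2)) * rel a 1
        + (-(cU a ^ 2 * cU' a * αU ^ 2 * ψU a ^ 2 * X 5 ^ 2)) * rel a 3
        + (-(X 4 * (hU a * X 5 + 1))) * rel a 6 := by
    simp only [rel, hU]; ring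
  rw [h]
  exact (deckIdeal a).add_mem ((deckIdeal a).add_mem ((deckIdeal a).mul_mem_left _ (rel_mem_deckIdeal a 1))
    ((deckIdeal a).mul_mem_left _ (rel_mem_deckIdeal a 3))) ((deckIdeal a).mul_mem_left _ (rel_mem_deckIdeal a 6))

end Base

/-! ### The standard étale pair `(X⁴ − g, h)` over `R₀` -/

section Quarter

variable {R : Type v} [CommRing R] [Algebra ℂ R]

/-- `¼ ∈ R`. [folklore] -/
private def quarter (R : Type v) [CommRing R] [Algebra ℂ R] : R := algebraMap ℂ R (1 / 4)

/-- `4 · ¼ = 1` in a `ℂ`-algebra. [folklore] -/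
private theorem four_mul_quarter : (4 : R) * quarter R = 1 := by
  rw [quarter, show (4 : R) = algebraMap ℂ R 4 by rw [map_ofNat], ← map_mul]
  norm_num

end Quarter

section Pair

variable {R : Type v} [CommRing R] [Algebra ℂ R] {e : ℕ} (a : CIdx e → R)

/-- **The standard étale pair of the chart**: `f = X⁴ − g`, `g = h` over `R₀ = R[u₀, u₁]`; standard étale because
`f′ · (¼ m X) + f · (−m) = g m = h⁴`. [cite: StacksProject, Tag 00UB] -/
def deckPair : StandardEtalePair (MvPolynomial (Fin 2) R) where
  f := Polynomial.X ^ 4 - Polynomial.C (g₂ a)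
  monic_f := Polynomial.monic_X_pow_sub_C _ (by norm_num)
  g := Polynomial.C (h₂ a)
  cond := by
    refine ⟨Polynomial.C (C (quarter R) * m₂ a) * Polynomial.X, -Polynomial.C (m₂ a), 4, ?_⟩
    have hq : (4 : Polynomial (MvPolynomial (Fin 2) R)) * Polynomial.C (C (quarter R)) = 1 := by
      rw [show (4 : Polynomial (MvPolynomial (Fin 2) R)) = Polynomial.C (C (4 : R)) by
        rw [map_ofNat, map_ofNat], ← map_mul, ← map_mul, four_mul_quarter, map_one, map_one]
    have hgm : Polynomial.C (g₂ a) * Polynomial.C (m₂ a) = (Polynomial.C (h₂ a)) ^ 4 := by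
      rw [← map_mul, ← map_pow, h₂_pow_four]
    simp only [Polynomial.derivative_sub, Polynomial.derivative_X_pow, Polynomial.derivative_C, sub_zero,
      map_mul, Nat.cast_ofNat, map_ofNat]
    linear_combination (Polynomial.C (m₂ a) * Polynomial.X ^ 4) * hq + hgm

/-- The pair's `f` is `X⁴ − g`. [cite: StacksProject, Tag 00UB] -/
@[simp] theorem deckPair_f : (deckPair a).f = Polynomial.X ^ 4 - Polynomial.C (g₂ a) := rfl

/-- The pair's `g` is `h`. [cite: StacksProject, Tag 00UB] -/
@[simp] theorem deckPair_g : (deckPair a).g = Polynomial.C (h₂ a) := rfl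

attribute [local instance] baseAlgebra isScalarTower_base

/-- `w ∈ DeckRing a` is a root of `f` with `g(w) = h` invertible. [cite: StacksProject, Tag 00UB] -/
theorem hasMap_w : (deckPair a).HasMap (Ideal.Quotient.mk (deckIdeal a) (X 2) : DeckRing a) := by
  constructor
  · rw [deckPair_f, map_sub, map_pow, Polynomial.aeval_X, Polynomial.aeval_C, mk_X2_pow_four,
      algebraMap_base_apply, toSix_g₂, sub_self]
  · rw [deckPair_g, Polynomial.aeval_C, algebraMap_base_apply, toSix_h₂]
    exact IsUnit.of_mul_eq_one _ (by rw [mul_comm]; exact mk_X5_mul_hU a)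

/-- **`Ψ : R₀[X][Y]/(f, Yh − 1) → DeckRing a`**, `X ↦ w` (`Y ↦ v`). [cite: StacksProject, Tag 00UB] -/
def deckLift : (deckPair a).Ring →ₐ[MvPolynomial (Fin 2) R] DeckRing a :=
  (deckPair a).lift _ (hasMap_w a)

/-- `Ψ X = w`. [cite: StacksProject, Tag 00UB] -/
@[simp] theorem deckLift_X : deckLift a (deckPair a).X = Ideal.Quotient.mk (deckIdeal a) (X 2) :=
  (deckPair a).lift_X _ _

/-- The element `Y` (inverse of `h`) of the standard étale algebra. [cite: StacksProject, Tag 00UB] -/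
def pairY : (deckPair a).Ring :=
  Ideal.Quotient.mk (Ideal.span {Polynomial.C (deckPair a).f, Polynomial.X * Polynomial.C (deckPair a).g - 1})
    Polynomial.X

/-- `g(X) = h` in the standard étale algebra. [cite: StacksProject, Tag 00UB] -/
theorem aeval_pairX_g :
    Polynomial.aeval (deckPair a).X (deckPair a).g = algebraMap (MvPolynomial (Fin 2) R) (deckPair a).Ring (h₂ a) := by
  rw [deckPair_g, Polynomial.aeval_C]

/-- `h · Y = 1` in the standard étale algebra. [cite: StacksProject, Tag 00UB] -/
theorem algebraMap_h₂_mul_pairY : algebraMap (MvPolynomial (Fin 2) R) (deckPair a).Ring (h₂ a) * pairY a = 1 := by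
  rw [← aeval_pairX_g]
  exact (deckPair a).aeval_X_g_mul_mk_X

/-- `X⁴ = g` in the standard étale algebra. [cite: StacksProject, Tag 00UB] -/
theorem pairX_pow_four : (deckPair a).X ^ 4 = algebraMap (MvPolynomial (Fin 2) R) (deckPair a).Ring (g₂ a) := by
  have h := (deckPair a).hasMap_X.1
  rw [deckPair_f, map_sub, map_pow, Polynomial.aeval_X, Polynomial.aeval_C, sub_eq_zero] at h
  exact h

/-- `Ψ Y = v`. [cite: StacksProject, Tag 00UB] -/
theorem deckLift_pairY : deckLift a (pairY a) = Ideal.Quotient.mk (deckIdeal a) (X 5) := by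
  have h1 : deckLift a (algebraMap _ (deckPair a).Ring (h₂ a)) * deckLift a (pairY a) = 1 := by
    rw [← map_mul, algebraMap_h₂_mul_pairY, map_one]
  rw [AlgHom.commutes, algebraMap_base_apply, toSix_h₂] at h1
  have h2 := mk_X5_mul_hU a
  -- both are inverses of `h`
  calc deckLift a (pairY a) = (Ideal.Quotient.mk (deckIdeal a) (X 5) * Ideal.Quotient.mk (deckIdeal a) (hU a)) *
        deckLift a (pairY a) := by rw [h2, one_mul]
    _ = Ideal.Quotient.mk (deckIdeal a) (X 5) * (Ideal.Quotient.mk (deckIdeal a) (hU a) * deckLift a (pairY a)) := by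
        rw [mul_assoc]
    _ = Ideal.Quotient.mk (deckIdeal a) (X 5) := by rw [h1, mul_one]

end Pair

end Literature.AlgebraicGeometry.HodgeTheory.Q8Family

end
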